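import Literature.Topology.PlanarFoliations.RestrictOpen
import Literature.Topology.PlanarFoliations.CompactLeaf
import Literature.Topology.FourManifolds.TautFoliationsClosedLeaves
import HarnessLib

/-!
# A compact leaf minus a point is an open leaf of the restricted foliation

Topic: Topology / PlanarFoliations, sequel to `RestrictOpen.lean` and `CompactLeaf.lean`. Let
`C = F.leaf x` be a compact leaf of a bi-oriented foliation `F : Foliation ℝ X` of a Hausdorff
second countable space and `z ∈ C`. In the restriction `F' = restrictOpen F {z}ᶜ`:

* `leaf_restrictOpen_punct_eq` (**proved**): **the leaf of `F'` through any point of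
  `C ∖ {z}` is all of `C ∖ {z}`** — it is relatively open in `C ∖ {z}` (closed leaves are
  proper: near each of its points `C` is a single plaque, `exists_isOpen_leaf_inter_eq_plaque`,
  and plaque pieces inside boxes are plaques of `F'`), so are the other leaves of `F'` meeting
  `C ∖ {z}`, and `C ∖ {z}` is connected (`isConnected_leaf_diff_singleton`);
* `noncompactSpace_leaf_punct` (**proved**): that leaf is **not compact** (its image `C ∖ {z}`
  is not closed: `z` is in its closure);
* `isClosed_leaf_punct` (**proved**): it is a closed leaf of `F'` (its image is `C ∩ {z}ᶜ`).

So the Poincaré–Bendixson theory of open leaves (`LeafOrder.lean`, …) applies to compact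
leaves after puncturing. All statements are [folklore].
-/

noncomputable section

open Set Filter Function TopologicalSpace
open _root_.Topology
open Literature.Topology.FourManifolds Literature.Topology.FourManifolds.Foliation

namespace Literature.Topology.PlanarFoliations

variable {X : Type*} [TopologicalSpace X]

section PunctDef

variable [T1Space X]

/-- The complement of a point as an open subset. [folklore] -/
def punct (z : X) : Opens X := ⟨{z}ᶜ, isOpen_compl_singleton⟩

/-- Membership in `punct z`. [folklore] -/
@[simp] theorem mem_punct_iff {z y : X} : y ∈ punct z ↔ y ≠ z := Iff.rfl

/-- The carrier of `punct z`. [folklore] -/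
@[simp] theorem coe_punct (z : X) : ((punct z : Opens X) : Set X) = {z}ᶜ := rfl

/-- In a nontrivial space the complement of a point is nonempty. [folklore] -/
instance nonempty_punct [Nontrivial X] (z : X) : Nonempty (punct z) := by
  obtain ⟨y, hy⟩ := exists_ne z
  exact ⟨⟨y, hy⟩⟩

end PunctDef

/-- A foliated space is nontrivial (a plaque has two points). [folklore] -/
theorem nontrivial_of_foliation (F : Foliation ℝ X) (x : X) : Nontrivial X := by
  obtain ⟨e, he, -⟩ := F.exists_mem_source x
  refine ⟨⟨e.symm (0, 0), e.symm (1, 0), fun h ↦ ?_⟩⟩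
  have := congrArg e h
  rw [e.right_inv (by rw [F.target_eq e he]; exact mem_univ _), e.right_inv (by rw [F.target_eq e he]; exact mem_univ _)] at this
  exact absurd (Prod.ext_iff.1 this).1 (by norm_num)

section Punct

variable [T2Space X] [SecondCountableTopology X] {F : Foliation ℝ X} {x : X}
variable [Nontrivial X] (hbi : IsBiOriented F) (hC : IsCompact (F.leaf x)) {z : X} (hz : z ∈ F.leaf x)

/-- **Local lemma**: around a point `w` of `C ∖ {z}` there is an open set of `punct z` whose
points of `C` lie on the `F'`-leaf of `w` (closed leaves are locally a single plaque, and plaque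
pieces inside boxes are plaques of the restriction). [folklore] -/
theorem exists_isOpen_forall_mem_leaf (hC : IsCompact (F.leaf x)) (w : punct z) (hw : (w : X) ∈ F.leaf x) :
    ∃ O : Set (punct z), IsOpen O ∧ w ∈ O ∧ ∀ v ∈ O, (v : X) ∈ F.leaf x → v ∈ (restrictOpen F (punct z)).leaf w := by
  obtain ⟨e, he, hwe⟩ := F.exists_mem_source (w : X)
  -- a box of `e` about `e w` inside `punct z`
  obtain ⟨r, hr, hsub⟩ := exists_renormBox_source_subset hwe ((punct z).2.mem_nhds w.2)
  -- an open set of `X` meeting `C` in the plaque of `w` only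
  obtain ⟨V, hVo, hwV, -, hV⟩ := F.exists_isOpen_leaf_inter_eq_plaque hC.isClosed he hw hwe
  refine ⟨Subtype.val ⁻¹' (V ∩ (renormBox e (e w) r hr).source), ?_, ?_, ?_⟩
  · exact (hVo.inter (renormBox e (e w) r hr).open_source).preimage continuous_subtype_val
  · exact ⟨hwV, mem_renormBox_source_self hwe hr⟩
  · rintro v ⟨hvV, hvs⟩ hvC
    have hvpl : (v : X) ∈ plaque e (e w).2 := by rw [← hV]; exact ⟨hvC, hvV⟩
    have hsp : (restrictOpen F (punct z)).SamePlaque w v :=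
      samePlaque_restrictOpen_of_mem_box he hr (hsub hr) (mem_renormBox_source_self hwe hr) hvs hvpl.2.symm
    exact hsp.mem_leaf

omit [Nontrivial X] in
/-- `C ∖ {z}` as a subset of `punct z` is connected. [folklore] -/
theorem isConnected_preimage_leaf_punct (hbi : IsBiOriented F) (hC : IsCompact (F.leaf x)) (hz : z ∈ F.leaf x) :
    IsConnected ((Subtype.val : punct z → X) ⁻¹' F.leaf x) := by
  have hconn := isConnected_leaf_diff_singleton hbi hC hz
  have himg : (Subtype.val : punct z → X) '' (Subtype.val ⁻¹' F.leaf x) = F.leaf x \ {z} := by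
    apply Subset.antisymm
    · rintro _ ⟨v, hv, rfl⟩
      exact ⟨hv, v.2⟩
    · rintro y ⟨hy, hyz⟩
      exact ⟨⟨y, hyz⟩, hy, rfl⟩
  refine ⟨?_, ?_⟩
  · obtain ⟨y, hy, hyz⟩ := hconn.1
    exact ⟨⟨y, hyz⟩, hy⟩
  · rw [← IsInducing.subtypeVal.isPreconnected_image]
    convert hconn.2 using 1
    exact himg

/-- **The leaf of the restriction through a point of `C ∖ {z}` is all of `C ∖ {z}`.**
[folklore] -/
theorem leaf_restrictOpen_punct_eq (hbi : IsBiOriented F) (hC : IsCompact (F.leaf x)) (hz : z ∈ F.leaf x)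
    (y : punct z) (hy : (y : X) ∈ F.leaf x) :
    (restrictOpen F (punct z)).leaf y = (Subtype.val : punct z → X) ⁻¹' F.leaf x := by
  set F' := restrictOpen F (punct z) with hF'
  set S : Set (punct z) := Subtype.val ⁻¹' F.leaf x with hS
  have hleafy : F.leaf (y : X) = F.leaf x := F.leaf_eq_of_mem hy
  -- every `F'`-leaf through a point of `S` lies in `S`
  have hsubS : ∀ w : punct z, (w : X) ∈ F.leaf x → F'.leaf w ⊆ S := fun w hw v hv ↦ by
    have := leaf_restrictOpen_subset w hv
    rw [mem_preimage, F.leaf_eq_of_mem hw] at this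
    exact this
  apply Subset.antisymm (hsubS y hy)
  -- open sets `A ⊇ F'.leaf y` and `B ⊇ S ∖ F'.leaf y`, disjoint on `S`
  choose O hOo hOmem hO using fun w : S ↦ exists_isOpen_forall_mem_leaf (z := z) hC w.1 w.2
  set A : Set (punct z) := ⋃ w : {w : S // (w : punct z) ∈ F'.leaf y}, O w.1 with hA
  set B : Set (punct z) := ⋃ w : {w : S // (w : punct z) ∉ F'.leaf y}, O w.1 with hB
  have hAo : IsOpen A := isOpen_iUnion fun w ↦ hOo w.1
  have hBo : IsOpen B := isOpen_iUnion fun w ↦ hOo w.1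
  have hAS : ∀ v ∈ A, v ∈ S → v ∈ F'.leaf y := by
    rintro v hv hvS
    obtain ⟨⟨⟨w₀, hw₀S⟩, hw₀y⟩, hvw⟩ := mem_iUnion.1 hv
    have h1 : v ∈ F'.leaf w₀ := hO ⟨w₀, hw₀S⟩ v hvw hvS
    rw [F'.leaf_eq_of_mem hw₀y] at h1
    exact h1
  have hBS : ∀ v ∈ B, v ∈ S → v ∉ F'.leaf y := by
    rintro v hv hvS hvy
    obtain ⟨⟨⟨w₀, hw₀S⟩, hw₀y⟩, hvw⟩ := mem_iUnion.1 hv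
    have h1 : v ∈ F'.leaf w₀ := hO ⟨w₀, hw₀S⟩ v hvw hvS
    -- then the leaves of `w₀` and `y` coincide, contradicting `w₀ ∉ F'.leaf y`
    have h2 : F'.leaf w₀ = F'.leaf v := (F'.leaf_eq_of_mem h1).symm
    have h3 : F'.leaf y = F'.leaf v := (F'.leaf_eq_of_mem hvy).symm
    apply hw₀y
    show w₀ ∈ F'.leaf y
    rw [h3, ← h2]
    exact F'.mem_leaf_self _
  have hcov : S ⊆ A ∪ B := by
    intro v hvS
    by_cases hvy : v ∈ F'.leaf y
    · exact Or.inl (mem_iUnion.2 ⟨⟨⟨v, hvS⟩, hvy⟩, hOmem _⟩)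
    · exact Or.inr (mem_iUnion.2 ⟨⟨⟨v, hvS⟩, hvy⟩, hOmem _⟩)
  -- connectedness of `S`
  have hSc := (isConnected_preimage_leaf_punct hbi hC hz).2
  intro v hvS
  by_contra hvy
  have hne₁ : (S ∩ A).Nonempty := ⟨y, hy, mem_iUnion.2 ⟨⟨⟨y, hy⟩, F'.mem_leaf_self y⟩, hOmem _⟩⟩
  have hne₂ : (S ∩ B).Nonempty := ⟨v, hvS, mem_iUnion.2 ⟨⟨⟨v, hvS⟩, hvy⟩, hOmem _⟩⟩
  obtain ⟨u, huS, huA, huB⟩ := hSc A B hAo hBo hcov hne₁ hne₂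
  exact hBS u huB huS (hAS u huA huS)

omit [T2Space X] [SecondCountableTopology X] [Nontrivial X] in
/-- `z` is in the closure of `C ∖ {z}` (a plaque through `z` has other points near `z`).
[folklore] -/
theorem mem_closure_leaf_diff (hz : z ∈ F.leaf x) : z ∈ closure (F.leaf x \ {z}) := by
  obtain ⟨e, he, hze⟩ := F.exists_mem_source z
  rw [mem_closure_iff_nhds]
  intro V hV
  -- points `e.symm ((e z).1 + ε, (e z).2)` tend to `z`
  have hcont : ContinuousAt (fun s : ℝ ↦ e.symm ((e z).1 + s, (e z).2)) 0 := by
    have hsymm : Continuous e.symm := by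
      have := e.continuousOn_symm; rw [F.target_eq e he, continuousOn_univ] at this; exact this
    exact (hsymm.comp (by fun_prop)).continuousAt
  have h0 : e.symm ((e z).1 + 0, (e z).2) = z := by
    rw [add_zero, Prod.mk.eta, e.left_inv hze]
  have hV' := hcont.preimage_mem_nhds (by rw [h0]; exact hV)
  obtain ⟨ε, hε, hball⟩ := Metric.mem_nhds_iff.1 hV'
  have hmem : (ε / 2 : ℝ) ∈ Metric.ball (0 : ℝ) ε := by
    rw [Metric.mem_ball, Real.dist_eq, sub_zero, abs_of_pos (by positivity)]; linarith
  refine ⟨e.symm ((e z).1 + ε / 2, (e z).2), hball hmem, ?_, ?_⟩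
  · -- on the plaque of `z`, hence in the leaf
    rw [← F.leaf_eq_of_mem hz]
    exact (F.plaque_subset_leaf_of_mem he (F.mem_leaf_self z) (mem_plaque_self hze)) (plaqueMap_mem_plaque F he _ _)
  · intro h
    rw [mem_singleton_iff] at h
    have := congrArg e h
    rw [e.right_inv (by rw [F.target_eq e he]; exact mem_univ _)] at this
    have := (Prod.ext_iff.1 this).1
    simp only at this
    linarith

/-- **The punctured compact leaf is not compact** (as a leaf of the restriction). [folklore] -/
theorem noncompactSpace_leaf_punct (hbi : IsBiOriented F) (hC : IsCompact (F.leaf x)) (hz : z ∈ F.leaf x)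
    (y : punct z) (hy : (y : X) ∈ F.leaf x) : NoncompactSpace ((restrictOpen F (punct z)).Leaf y) := by
  set F' := restrictOpen F (punct z) with hF'
  refine ⟨fun hcpt ↦ ?_⟩
  -- the image of the leaf in `X` is `C ∖ {z}`, compact hence closed: but `z` is in its closure
  set f : F'.Leaf y → X := fun q ↦ ((ofLeafSpace (q : F'.LeafSpace) : punct z) : X) with hf
  have hfc : Continuous f := continuous_subtype_val.comp (Leaf.continuous_coe F' y)
  have himg : f '' univ = F.leaf x \ {z} := by
    apply Subset.antisymm
    · rintro _ ⟨q, -, rfl⟩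
      have hq : (ofLeafSpace (q : F'.LeafSpace) : punct z) ∈ F'.leaf y := q.2
      rw [leaf_restrictOpen_punct_eq hbi hC hz y hy] at hq
      exact ⟨hq, (ofLeafSpace (q : F'.LeafSpace) : punct z).2⟩
    · rintro v ⟨hv, hvz⟩
      have hv' : (⟨v, hvz⟩ : punct z) ∈ F'.leaf y := by
        rw [leaf_restrictOpen_punct_eq hbi hC hz y hy]; exact hv
      exact ⟨Leaf.mk ⟨v, hvz⟩ hv', mem_univ _, rfl⟩
  have hK : IsCompact (F.leaf x \ {z}) := by rw [← himg]; exact hcpt.image hfc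
  have hcl := hK.isClosed
  have := hcl.closure_subset_iff.2 Subset.rfl (mem_closure_leaf_diff hz)
  exact this.2 rfl

/-- **The punctured compact leaf is a closed leaf of the restriction** (its carrier is
`C ∩ {z}ᶜ`, closed in `{z}ᶜ`). [folklore] -/
theorem isClosed_leaf_punct (hbi : IsBiOriented F) (hC : IsCompact (F.leaf x)) (hz : z ∈ F.leaf x)
    (y : punct z) (hy : (y : X) ∈ F.leaf x) : IsClosed ((restrictOpen F (punct z)).leaf y) := by
  rw [leaf_restrictOpen_punct_eq hbi hC hz y hy]
  exact hC.isClosed.preimage continuous_subtype_val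

end Punct

end Literature.Topology.PlanarFoliations
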